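import Summits.HodgeConjecture.HodgeConjecture.Theses.FiniteTreeOfFlavours
import Literature.AlgebraicGeometry.Motives.UniversalHypersurfaceAlgebraicPoints
import HarnessLib

/-!
# Crux `RigidImpliesQbar` (stmt-HodgeConjecture-1494), line `birth` — STUB A
# `stub_qbarClosed_has_algebraic_point`, PROVED (body verbatim, `IsQbarClosed` unfolded)

Route `FiniteTreeOfFlavours` of `HodgeConjecture`. The registered skeleton
`Cruxes/RigidImpliesQbar/Lines/birth.lean` decomposes the crux (a rigid rational `(k,k)`-class on a
smooth hypersurface forces a model over `ℚ̄`) into STUB G (the Hodge locus of a rigid class lies in the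
isomorphism locus), STUB H (such an isolated Hodge locus is `ℚ̄`-closed) and STUB A, the ARITHMETIC
DESCENT:

> a non-empty `ℚ̄`-closed subset of `U(ℂ)` — Zariski closed on points and stable under every
> automorphism of `ℂ` fixing the algebraic numbers, acting through the coefficients `t ↦ [τ(F_t)]` —
> contains a point with algebraic coefficients,

`U = base ℂ n d` being the parameter space of nonsingular forms of degree `d` on `ℙⁿ⁺¹` (an open of the
affine space of forms, defined over `ℚ`). The skeleton spells "`ℚ̄`-closed" through two file-local
definitions (`IsQbarClosed`, `conjPt`, in the `Cruxes` work-file, not importable here); this file proves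
the stub with those two definitions UNFOLDED — `IsQbarClosed Z` is by definition the conjunction of the
second and third hypotheses below, `conjPt τ t` is by definition the `pointOfForm` term — so that the
registered stub is the one-liner `fun n d Z hne hZ ↦ Theorems.qbarClosed_has_algebraic_point Z hne hZ.1 hZ.2`.

The mathematics is the Literature theorem
`UniversalHypersurface.exists_mem_forall_isAlgebraic_coeff_pointForm`
(`Literature/AlgebraicGeometry/Motives/UniversalHypersurfaceAlgebraicPoints.lean`): in coefficient
coordinates `Z` is a locally closed `V(I) ∖ V(𝔡) ⊆ ℂ^{#monomials}` with both pieces `Aut(ℂ/ℚ̄)`-stable;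
the vanishing ideals of stable sets are stable, hence spanned by polynomials with algebraic coefficients
(descent of `Aut(ℂ/ℚ̄)`-stable subspaces, the fixed field of `Aut(ℂ/ℚ̄)` being `ℚ̄` — Lang, *Algebra*
VIII §1; Borel AG §14); Hilbert's Nullstellensatz over the algebraically closed field `ℚ̄` applied to the
Rabinowitsch ideal then produces the point (`FieldTheory/AlgClosed/AutStableSetAlgebraicPoint.lean`,
Lang, *Introduction to Algebraic Geometry* III §5, C4 ⟹ C7). No named fact, no sorry.

## References

* [Lang1958IAG] S. Lang, Introduction to Algebraic Geometry (1958), Ch. III §4 Thm. 9 and §5, C4–C7.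
* [Voisin2007HodgeLoci] C. Voisin, Hodge loci and absolute Hodge classes, Compos. Math. 143 (2007),
  Lemma 1.4 and §3.
* [Hartshorne1977] R. Hartshorne, Algebraic Geometry (1977), I Thm. 1.3A (Nullstellensatz).
-/

noncomputable section

-- `Summit.HodgeConjecture.HodgeConjecture.…` is the mandated namespace (single-conjunct summit).
set_option linter.dupNamespace false

namespace Summit.HodgeConjecture.HodgeConjecture.Theorems

open Literature.AlgebraicGeometry.Motives
open Literature.AlgebraicGeometry.Motives.UniversalHypersurface

/-- **STUB A of crux `RigidImpliesQbar` (stmt-HodgeConjecture-1494), arithmetic descent — a non-empty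
`ℚ̄`-closed subset of `U(ℂ)` contains a point with algebraic coefficients.** For `Z ⊆ U(ℂ)`
(`U = base ℂ n d`, nonsingular forms of degree `d` on `ℙⁿ⁺¹`) non-empty, Zariski closed on points, and
stable under `t ↦ [τ(F_t)]` for every automorphism `τ` of `ℂ` fixing every algebraic number, some
`t ∈ Z` has a form `F_t` all of whose coefficients are algebraic over `ℚ`. This is the registered stub
`stub_qbarClosed_has_algebraic_point` with the skeleton's `IsQbarClosed Z` unfolded into its two
conjuncts (hypotheses 3 and 4) and `conjPt τ t` unfolded into its defining `pointOfForm` term.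
[cite: Lang1958IAG, Ch. III §5, C4–C7] [cite: Voisin2007HodgeLoci, Lemma 1.4] -/
theorem qbarClosed_has_algebraic_point :
    ∀ ⦃n d : ℕ⦄ (Z : Set (ComplexPoints (base ℂ n d))), Z.Nonempty →
      IsZariskiClosedOnPoints (base ℂ n d) Z →
      (∀ τ : ℂ ≃+* ℂ, (∀ z : ℂ, IsAlgebraic ℚ z → τ z = z) → ∀ t ∈ Z,
        pointOfForm ℂ n d ((isHomogeneous_pointForm ℂ n d t).map τ.toRingHom)
          ((isNonsingularForm_pointForm ℂ n d t).map τ.toRingHom) ∈ Z) →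
      ∃ t ∈ Z, ∀ m, IsAlgebraic ℚ ((pointForm ℂ n d t).coeff m) :=
  fun n d Z hne hZ hstab ↦ exists_mem_forall_isAlgebraic_coeff_pointForm n d Z hne hZ hstab

end Summit.HodgeConjecture.HodgeConjecture.Theorems

end
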